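import Summits.BirchSwinnertonDyer.BirchSwinnertonDyer.Theorems.PrintCf2SplitBadTwoUpperBaseLiftFrameLayers
import HarnessLib

/-!
# Crux `PrintCf2.SplitBadTwoRankOneOfFacts` (stmt-BirchSwinnertonDyer-20368), skeleton v13.5 (S3a-quad-DA child 24086, M-LINE-PIN stub (R)
# `stub_xRegularInner`), THE LIMIT STEP ON THE `v`-LINE: (LSₙ,₁) for `n ≥ n₁` ⟹ (LS↑₁) — the `κ₁`-twin of p700332
# `locSurj_of_layers_of_isUnramifiedOutside`, answering LEAD g14 07:39:56Z «is the LIMIT line-generic?» (yes: p700059 `locSurj_of_layers` is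
# stated for ANY `ℤ_p`-extension `κ`; only its non-splitting input is frame-specific, and it holds on the `v`-line as well)

Cell `bsd-print-cf2`, EXTRA WIDTH seat `bsd-line-cf2-p1-w4` g14 (prover-bsd-line-cf2-p1-w4-g14-0); `--supports stmt-BirchSwinnertonDyer-20368`
(helper, Theses-free). HONEST FRAMING: nothing here closes the crux or a registered stub; BSD is not proved by any of this; no summit
statement is proved by this seat. No definition, no named fact, no `sorry`.

WHAT. For `K` imaginary quadratic, `p = v v̄`, and a `ℤ_p`-extension `κ₁` UNRAMIFIED OUTSIDE `v` (the `v`-line `K^{(v)}_∞`, Müller's `𝔭 := v` line,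
slot 1 of the doubly adapted pair):
* **`not_decomp_le_kerSubgroup_of_isUnramifiedOutside_v`** — no place `w ∤ p` and no place above `p` splits completely in `K^{(v)}_∞`:
  `∀ w, (p ∉ w ∨ w = v̄) → ¬ D_w ≤ ker κ₁` (off `v`: -w8 g2's (C1) `LineDecomposition.decomp_not_le_kerSubgroup_of_isUnramifiedOutside` with the
  roles of `v, v̄` exchanged; at `v̄`: `ZpExtension.not_decomp_le_kerSubgroup_of_isImaginaryQuadratic` — no prime above `p` splits completely in
  ANY `ℤ_p`-extension of an imaginary quadratic field); also the all-places form `…_v_all`.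
* **`locSurj_of_layers_of_isUnramifiedOutside_v`** — (LSₙ,₁): local surjectivity modulo unramified classes over the layers
  `U = κ₁.layerSubgroup n` (`n ≥ n₁`), Selmer places «`w ∤ p` or `w = v̄`» (unchanged) ⟹ (LS↑₁): the same over `U = ker κ₁` — the `hLS` binder of
  LEAD g14's socket `XRegInner.stub_xRegularInner_of_locSurj₁` (and of -w2 g14's `XRegPinned.xRegular_char_of_locSurj` applied to the swapped
  pair). So every R2 brick run with `U := Gal(K̄/K^{(v)}_n)` feeds (R) through ONE more application.
presearch: as p700059/p700332 (GV 2000 Prop. 2.1, Serre I §2.2 Prop. 8); no new fact. beyond-print theorem: no.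

References: [GreenbergVatsal2000] §2 Prop. 2.1; [deShalit1987] Ch. II §1.1; [Washington1997] §13; [SerreGaloisCohomology1997] I §2.2 Prop. 8.
-/

noncomputable section

open scoped Classical

set_option linter.dupNamespace false
set_option autoImplicit false

open NumberField IsDedekindDomain Field
open Literature.NumberTheory.EllipticCurves Literature.NumberTheory.EllipticCurves.GreenbergSelmer
open Literature.NumberTheory.EllipticCurves.GreenbergVatsal2000
open Literature.NumberTheory.GaloisRepresentations
open Summit.BirchSwinnertonDyer.Rank1Residual.X11b

namespace Summit.BirchSwinnertonDyer.BirchSwinnertonDyer.Theorems.PrintCf2.UpperBaseLift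

variable {K : Type} [Field K] [NumberField K] {p : ℕ} [Fact p.Prime]
  (M : Type) [AddCommGroup M] [DistribMulAction (absoluteGaloisGroup K) M] [TopologicalSpace M] [DiscreteTopology M]

/-- **No place of `K` splits completely in the `v`-line `K^{(v)}_∞`** (`K` imaginary quadratic, `p = v v̄`, `κ₁` unramified outside `v`), all places:
off `v` by (C1) with `v ↔ v̄` exchanged, at `v` by `not_decomp_le_kerSubgroup_of_isImaginaryQuadratic`. [cite: deShalit1987, Ch. II §1.1]
[cite: Washington1997, §13] -/
theorem not_decomp_le_kerSubgroup_of_isUnramifiedOutside_v_all (hK : IsImaginaryQuadratic K) {v vbar : HeightOneSpectrum (𝓞 K)}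
    (hv : ((p : ℕ) : 𝓞 K) ∈ v.asIdeal) (hvbar : ((p : ℕ) : 𝓞 K) ∈ vbar.asIdeal) (hne : vbar ≠ v) (κ₁ : ZpExtension K p)
    (hκ₁ : κ₁.IsUnramifiedOutside v) (w : HeightOneSpectrum (𝓞 K)) : ¬ decomp (K := K) w ≤ κ₁.kerSubgroup := by
  by_cases hw : w = v
  · subst hw
    exact ZpExtension.not_decomp_le_kerSubgroup_of_isImaginaryQuadratic hK κ₁ hv
  · exact LineDecomposition.decomp_not_le_kerSubgroup_of_isUnramifiedOutside hK hvbar hv hne.symm κ₁ hκ₁ hw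

/-- **No place `w ∤ p`, and no place above `p`, splits completely in the `v`-line** — the `hD` input of p700059 `locSurj_of_layers` for `κ := κ₁`
with the Selmer places «`w ∤ p` or `w = v̄`». [cite: deShalit1987, Ch. II §1.1] [cite: Washington1997, §13] -/
theorem not_decomp_le_kerSubgroup_of_isUnramifiedOutside_v (hK : IsImaginaryQuadratic K) {v vbar : HeightOneSpectrum (𝓞 K)}
    (hv : ((p : ℕ) : 𝓞 K) ∈ v.asIdeal) (hvbar : ((p : ℕ) : 𝓞 K) ∈ vbar.asIdeal) (hne : vbar ≠ v) (κ₁ : ZpExtension K p)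
    (hκ₁ : κ₁.IsUnramifiedOutside v) :
    ∀ w : HeightOneSpectrum (𝓞 K), (((p : ℕ) : 𝓞 K) ∉ w.asIdeal ∨ w = vbar) → ¬ decomp (K := K) w ≤ κ₁.kerSubgroup :=
  fun w _ ↦ not_decomp_le_kerSubgroup_of_isUnramifiedOutside_v_all hK hv hvbar hne κ₁ hκ₁ w

/-- **(LSₙ,₁) for `n ≥ n₁` ⟹ (LS↑₁), ON THE `v`-LINE** (`K` imaginary quadratic, `p = v v̄`, `κ₁` unramified outside `v`): p700059 `locSurj_of_layers`
at `κ := κ₁` with its non-splitting input discharged; Selmer places «`w ∤ p` or `w = v̄`» as in the `v̄`-line statement (p700332). The conclusion is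
the `hLS` binder of `XRegInner.stub_xRegularInner_of_locSurj₁` (LEAD g14) / of `XRegPinned.xRegular_char_of_locSurj` on the swapped pair.
[cite: GreenbergVatsal2000, §2 Prop. 2.1 (pp. 17–21)] [cite: SerreGaloisCohomology1997, I §2.2 Prop. 8] -/
theorem locSurj_of_layers_of_isUnramifiedOutside_v (hK : IsImaginaryQuadratic K) {v vbar : HeightOneSpectrum (𝓞 K)}
    (hv : ((p : ℕ) : 𝓞 K) ∈ v.asIdeal) (hvbar : ((p : ℕ) : 𝓞 K) ∈ vbar.asIdeal) (hne : vbar ≠ v) (κ₁ : ZpExtension K p)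
    (hκ₁ : κ₁.IsUnramifiedOutside v)
    (hstab : ∀ m : M, IsOpen (MulAction.stabilizer (absoluteGaloisGroup K) m : Set (absoluteGaloisGroup K))) (n₁ : ℕ)
    (hLSn : ∀ n : ℕ, n₁ ≤ n → ∀ (T : Finset (HeightOneSpectrum (𝓞 K))), (∀ w ∈ T, ((p : ℕ) : 𝓞 K) ∉ w.asIdeal ∨ w = vbar) →
      ∀ τ' : (w : HeightOneSpectrum (𝓞 K)) →
        DoubleCoset.Quotient (decomp (K := K) w : Set (absoluteGaloisGroup K)) (κ₁.layerSubgroup n : Set (absoluteGaloisGroup K)) →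
          subgroupH1 (decompIn (κ₁.layerSubgroup n) w) M,
      ∃ z' : subgroupH1 (κ₁.layerSubgroup n) M,
        (∀ w ∈ T, ∀ Q : DoubleCoset.Quotient (decomp (K := K) w : Set (absoluteGaloisGroup K)) (κ₁.layerSubgroup n : Set (absoluteGaloisGroup K)),
          resOfLe M (inertiaIn_le_decompIn (κ₁.layerSubgroup n) w)
            (resH1Hom (decompInToH (κ₁.layerSubgroup n) w) (AddMonoidHom.id M) (fun _ _ ↦ rfl) (conjH1 (κ₁.layerSubgroup n) M Q.out z') -
              τ' w Q) = 0) ∧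
        (∀ w : HeightOneSpectrum (𝓞 K), w ∉ T → (((p : ℕ) : 𝓞 K) ∉ w.asIdeal ∨ w = vbar) →
          ∀ σ : absoluteGaloisGroup K, conjH1 (κ₁.layerSubgroup n) M σ z' ∈ unramifiedKer (κ₁.layerSubgroup n) M w)) :
    ∀ (T : Finset (HeightOneSpectrum (𝓞 K))), (∀ w ∈ T, ((p : ℕ) : 𝓞 K) ∉ w.asIdeal ∨ w = vbar) →
      ∀ τ : (w : HeightOneSpectrum (𝓞 K)) →
        DoubleCoset.Quotient (decomp (K := K) w : Set (absoluteGaloisGroup K)) (κ₁.kerSubgroup : Set (absoluteGaloisGroup K)) →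
          subgroupH1 (decompIn κ₁.kerSubgroup w) M,
      ∃ z : subgroupH1 κ₁.kerSubgroup M,
        (∀ w ∈ T, ∀ q : DoubleCoset.Quotient (decomp (K := K) w : Set (absoluteGaloisGroup K)) (κ₁.kerSubgroup : Set (absoluteGaloisGroup K)),
          resOfLe M (inertiaIn_le_decompIn κ₁.kerSubgroup w)
            (resH1Hom (decompInToH κ₁.kerSubgroup w) (AddMonoidHom.id M) (fun _ _ ↦ rfl) (conjH1 κ₁.kerSubgroup M q.out z) - τ w q) = 0) ∧
        (∀ w : HeightOneSpectrum (𝓞 K), w ∉ T → (((p : ℕ) : 𝓞 K) ∉ w.asIdeal ∨ w = vbar) →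
          ∀ σ : absoluteGaloisGroup K, conjH1 κ₁.kerSubgroup M σ z ∈ unramifiedKer κ₁.kerSubgroup M w) :=
  locSurj_of_layers κ₁ M hstab (not_decomp_le_kerSubgroup_of_isUnramifiedOutside_v hK hv hvbar hne κ₁ hκ₁) n₁ hLSn

end Summit.BirchSwinnertonDyer.BirchSwinnertonDyer.Theorems.PrintCf2.UpperBaseLift

end
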